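import Mathlib
import HarnessLib
import Literature.Analysis.FluidPDE.Tao2016AveragedNS.LocalCascadeSolutions
import Literature.Analysis.FluidPDE.Tao2016AveragedNS.RenormalisedCascadeWaves
import Literature.Analysis.FluidPDE.Tao2016AveragedNS.SelfSimilarCascadeBlowup
import Literature.Analysis.FluidPDE.Tao2016AveragedNS.ViscousEternalSolutions
import Literature.Analysis.FluidPDE.Tao2016AveragedNS.BoundedEternalSolutions
import Summits.NavierStokesRegularity.NavierStokesRegularity.Theses.TaoLadderRungTwoBreak
import Summits.NavierStokesRegularity.NavierStokesRegularity.Theorems.TaoLadderRungTwoBreakNoSurvivingEternalViscBddOneBlockResidueFloor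

/-!
# The block residue floor ON THE CRUX'S BINDERS: survivors of K1ᵛ(1) `TaoLadderRungTwoBreak.NoSurvivingEternalViscBddOne`
# (stmt-NavierStokesRegularity-20419) leave PERMANENT block wakes on infinitely many shells — every table of every class `E₂(R)`

MODEL lattice ODEs only (Tao 2016 §4, §6.4; cell vocabulary `IsEternalVisc`, `IsEternal`, `UniformBound`, `EternalSurvivingFwd`,
`physEnergy`); nothing here is a statement about the Navier–Stokes equations; no stub, crux, rung or summit is proved
(`--supports stmt-NavierStokesRegularity-20419`).  Sequel to `…BlockResidueFloor` (`survivalEvent_blockWake`): here the survival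
events are those of the crux's own hypothesis `EternalSurvivingFwd 1 ε₀ W`, the energy bound `K` is the tree's uniform one
(`exists_uniform_physEnergy_le`) and the action budget `𝓜` is the admissibility clause of `IsEternalVisc`.

* `survivor_permanent_blockWakes` — for a uniformly bounded admissible eternal solution (any `ν̂ ≥ 0`) of a CANCELLING table that
  is forward (S₁)-surviving: there are `c > 0`, `K ≥ 0`, `𝓜` such that for every `N` some shell `n ≥ N` and log-time `σ ≥ N` satisfy,
  for ALL `σ₂ ≥ σ`, `Σ_{1≤k≤n}E_k(σ₂) ≥ exp(−(2C_AΛ⁻¹𝓜 + 2ν̂(1+ε₀)^{2n}e^{−σ}))·c(1+ε₀)^{−n} − 2C_AK√K e^{−σ}`;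
* `survivor_permanent_blockWakes_inviscid` — the (ρ0) class (`IsEternal`, `ν̂ = 0`): the retention factor is the CONSTANT `e^{−2C_AΛ⁻¹𝓜}`;
* `survivor_permanent_blockWakes_of_inTableClass` / `…_inviscid_of_inTableClass` — the same on the crux's binders
  (`InTableClass R α` supplies the cancellation (4.3)).

READING for ⟨20419⟩: on a general (backscattering) table of `E₂(R)` forward (S₁)-survival forces, infinitely often, a PERMANENT deposit
`≳ e^{−2C_AΛ⁻¹𝓜}·c·(1+ε₀)^{−n}` in the shells `1 … n` (up to the late-starvation error `O(e^{−σ})`, negligible at front-passage times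
`σ ≈ 2n·log(1+ε₀)`); the sign-coherent per-shell wake floor of `…WakeEquivalence` is the special case where the deposit cannot move
down.  HONEST LABEL: a corollary of an a-priori estimate; (ρ0), (ρ+), ⟨20419⟩ and every NS statement remain OPEN; rung 0.
-/

noncomputable section

-- the summit and its single sub-problem share the name (CONVENTIONS §1)
set_option linter.dupNamespace false

namespace Summit.NavierStokesRegularity.NavierStokesRegularity.Theorems.NoSurvivingEternalViscBddOne.BlockResidueFloor

open Set Filter Topology MeasureTheory
open scoped RealInnerProductSpace
open Literature.Analysis.FluidPDE Literature.Analysis.FluidPDE.TaoCascade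
open Summit.NavierStokesRegularity.NavierStokesRegularity.Theses.TaoLadderRungTwoBreak
open Summit.NavierStokesRegularity.NavierStokesRegularity.Theorems.NoSurvivingEternalViscBddOne.SmallAction
open Summit.NavierStokesRegularity.NavierStokesRegularity.Theorems.NoSurvivingEternalViscBddOne.SurvivorEnergyBound

variable {m : ℕ} {ε₀ νh : ℝ} {α : Fin m → Fin m → Fin m → ℤ × ℤ × ℤ → ℝ} {W : ℤ → ℝ → Em m}

/-- **Survivors leave permanent block wakes on infinitely many shells** (any `ν̂ ≥ 0`, every cancelling table, no sign assumption):
if `W` is a uniformly bounded admissible eternal solution that is forward (S₁)-surviving, then with the tree's uniform energy bound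
`K` and the admissibility action budget `𝓜`, for every `N` there are `n ≥ N` (`n ≥ 1`) and `σ ≥ N` such that for ALL `σ₂ ≥ σ`
`exp(−(2C_AΛ⁻¹𝓜 + 2ν̂(1+ε₀)^{2n}e^{−σ}))·c(1+ε₀)^{−n} − 2C_AK√K e^{−σ} ≤ Σ_{j<n}E_{1+j}(σ₂)`.
[cite: Tao2016AveragedNS, §4 Lemma 4.1 (4.8)–(4.10) with (4.3), the viscous equation before Thm. 4.2, §6.4; tree `survivalEvent_blockWake`, `exists_uniform_physEnergy_le`] -/
theorem survivor_permanent_blockWakes (hε : 0 < ε₀) (hW : IsEternalVisc ε₀ νh α W) (hc : IsCancellingCoeff α)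
    (hU : UniformBound W) (hS : EternalSurvivingFwd 1 ε₀ W) :
    ∃ c K 𝓜 : ℝ, 0 < c ∧ 0 ≤ K ∧ (∀ (n : ℕ) (σ : ℝ), physEnergy ε₀ W n σ ≤ K) ∧
      (∀ n : ℤ, Integrable (fun σ => ‖W n σ‖) ∧ ∫ σ, ‖W n σ‖ ≤ 𝓜) ∧
      ∀ N : ℕ, ∃ n : ℕ, N ≤ n ∧ 1 ≤ n ∧ ∃ σ : ℝ, (N : ℝ) ≤ σ ∧ ∀ σ₂ : ℝ, σ ≤ σ₂ →
        Real.exp (-(2 * fluxConst α * (bigLam ε₀)⁻¹ * 𝓜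
              + 2 * νh * (1 + ε₀) ^ ((2 : ℝ) * ((n : ℤ) : ℝ)) * Real.exp (-σ))) * (c * ((1 + ε₀) ^ n)⁻¹)
            - 2 * fluxConst α * (K * Real.sqrt K) * Real.exp (-σ)
          ≤ ∑ j ∈ Finset.range n, physEnergy ε₀ W ((0 : ℕ) + 1 + j : ℤ) σ₂ := by
  obtain ⟨K, hK0, hK⟩ := exists_uniform_physEnergy_le hε hW hc hU
  obtain ⟨𝓜, h𝓜⟩ := hW.action
  obtain ⟨c, hc0, hev⟩ := hS
  refine ⟨c, K, 𝓜, hc0, hK0.le, hK, h𝓜, fun N => ?_⟩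
  obtain ⟨n, hNn, σ, hNσ, hle⟩ := hev (N + 1)
  refine ⟨n, by omega, by omega, σ, ?_, fun σ₂ h2 => ?_⟩
  · have : (N : ℝ) ≤ ((N + 1 : ℕ) : ℝ) := by push_cast; linarith
    exact this.trans hNσ
  · exact survivalEvent_blockWake hε hW hc hK0.le hK h𝓜 (by omega) hle h2

/-- **The (ρ0) class (`ν̂ = 0`).**  For a uniformly bounded admissible INVISCID eternal solution of a cancelling table that is forward
(S₁)-surviving, the retention factor is the constant `e^{−2C_AΛ⁻¹𝓜}`: for every `N` there are `n ≥ N`, `σ ≥ N` with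
`e^{−2C_AΛ⁻¹𝓜}·c(1+ε₀)^{−n} − 2C_AK√K e^{−σ} ≤ Σ_{j<n}E_{1+j}(σ₂)` for ALL `σ₂ ≥ σ`.
[cite: Tao2016AveragedNS, §4 Lemma 4.1 (4.8)–(4.10) with (4.3), §6.4; this file] -/
theorem survivor_permanent_blockWakes_inviscid (hε : 0 < ε₀) (hW : IsEternal ε₀ α W) (hc : IsCancellingCoeff α)
    (hU : UniformBound W) (hS : EternalSurvivingFwd 1 ε₀ W) :
    ∃ c K 𝓜 : ℝ, 0 < c ∧ 0 ≤ K ∧ (∀ (n : ℕ) (σ : ℝ), physEnergy ε₀ W n σ ≤ K) ∧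
      (∀ n : ℤ, Integrable (fun σ => ‖W n σ‖) ∧ ∫ σ, ‖W n σ‖ ≤ 𝓜) ∧
      ∀ N : ℕ, ∃ n : ℕ, N ≤ n ∧ 1 ≤ n ∧ ∃ σ : ℝ, (N : ℝ) ≤ σ ∧ ∀ σ₂ : ℝ, σ ≤ σ₂ →
        Real.exp (-(2 * fluxConst α * (bigLam ε₀)⁻¹ * 𝓜)) * (c * ((1 + ε₀) ^ n)⁻¹)
            - 2 * fluxConst α * (K * Real.sqrt K) * Real.exp (-σ)
          ≤ ∑ j ∈ Finset.range n, physEnergy ε₀ W ((0 : ℕ) + 1 + j : ℤ) σ₂ := by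
  obtain ⟨c, K, 𝓜, hc0, hK0, hK, h𝓜, hall⟩ := survivor_permanent_blockWakes hε hW.isEternalVisc hc hU hS
  refine ⟨c, K, 𝓜, hc0, hK0, hK, h𝓜, fun N => ?_⟩
  obtain ⟨n, hNn, hn1, σ, hNσ, hwake⟩ := hall N
  refine ⟨n, hNn, hn1, σ, hNσ, fun σ₂ h2 => ?_⟩
  have h := hwake σ₂ h2
  simpa only [zero_mul, mul_zero, add_zero] using h

/-- **On the crux's binders** (`α ∈ E₂(R)` supplies the cancellation (4.3)): every uniformly bounded admissible eternal solution
(any `ν̂ ≥ 0`) of a table of `InTableClass R` that is forward (S₁)-surviving leaves permanent block wakes on infinitely many shells.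
[cite: Tao2016AveragedNS, §4 (4.2)–(4.3), Lemma 4.1 (4.8)–(4.10), the viscous equation before Thm. 4.2, §6.4; this file] -/
theorem survivor_permanent_blockWakes_of_inTableClass {R : ℝ} {α : Fin 4 → Fin 4 → Fin 4 → ℤ × ℤ × ℤ → ℝ}
    {W : ℤ → ℝ → Em 4} (hε : 0 < ε₀) (hα : InTableClass R α) (hW : IsEternalVisc ε₀ νh α W)
    (hU : UniformBound W) (hS : EternalSurvivingFwd 1 ε₀ W) :
    ∃ c K 𝓜 : ℝ, 0 < c ∧ 0 ≤ K ∧ (∀ (n : ℕ) (σ : ℝ), physEnergy ε₀ W n σ ≤ K) ∧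
      (∀ n : ℤ, Integrable (fun σ => ‖W n σ‖) ∧ ∫ σ, ‖W n σ‖ ≤ 𝓜) ∧
      ∀ N : ℕ, ∃ n : ℕ, N ≤ n ∧ 1 ≤ n ∧ ∃ σ : ℝ, (N : ℝ) ≤ σ ∧ ∀ σ₂ : ℝ, σ ≤ σ₂ →
        Real.exp (-(2 * fluxConst α * (bigLam ε₀)⁻¹ * 𝓜
              + 2 * νh * (1 + ε₀) ^ ((2 : ℝ) * ((n : ℤ) : ℝ)) * Real.exp (-σ))) * (c * ((1 + ε₀) ^ n)⁻¹)
            - 2 * fluxConst α * (K * Real.sqrt K) * Real.exp (-σ)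
          ≤ ∑ j ∈ Finset.range n, physEnergy ε₀ W ((0 : ℕ) + 1 + j : ℤ) σ₂ :=
  survivor_permanent_blockWakes hε hW hα.2.1 hU hS

/-- **On the (ρ0) binders** (`IsEternal`, `α ∈ E₂(R)`): every uniformly bounded admissible inviscid eternal solution of a table of
`InTableClass R` that is forward (S₁)-surviving leaves, infinitely often, a permanent deposit `≥ e^{−2C_AΛ⁻¹𝓜}c(1+ε₀)^{−n} − 2C_AK√K e^{−σ}`
in the shells `1 … n`.  What (ρ0) `NoSurvivingEternalBddOne` asserts is that no such solution exists below a threshold in `ε₀`.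
[cite: Tao2016AveragedNS, §4 (4.2)–(4.3), Lemma 4.1 (4.8)–(4.10), §6.4; this file] -/
theorem survivor_permanent_blockWakes_inviscid_of_inTableClass {R : ℝ} {α : Fin 4 → Fin 4 → Fin 4 → ℤ × ℤ × ℤ → ℝ}
    {W : ℤ → ℝ → Em 4} (hε : 0 < ε₀) (hα : InTableClass R α) (hW : IsEternal ε₀ α W)
    (hU : UniformBound W) (hS : EternalSurvivingFwd 1 ε₀ W) :
    ∃ c K 𝓜 : ℝ, 0 < c ∧ 0 ≤ K ∧ (∀ (n : ℕ) (σ : ℝ), physEnergy ε₀ W n σ ≤ K) ∧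
      (∀ n : ℤ, Integrable (fun σ => ‖W n σ‖) ∧ ∫ σ, ‖W n σ‖ ≤ 𝓜) ∧
      ∀ N : ℕ, ∃ n : ℕ, N ≤ n ∧ 1 ≤ n ∧ ∃ σ : ℝ, (N : ℝ) ≤ σ ∧ ∀ σ₂ : ℝ, σ ≤ σ₂ →
        Real.exp (-(2 * fluxConst α * (bigLam ε₀)⁻¹ * 𝓜)) * (c * ((1 + ε₀) ^ n)⁻¹)
            - 2 * fluxConst α * (K * Real.sqrt K) * Real.exp (-σ)
          ≤ ∑ j ∈ Finset.range n, physEnergy ε₀ W ((0 : ℕ) + 1 + j : ℤ) σ₂ :=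
  survivor_permanent_blockWakes_inviscid hε hW hα.2.1 hU hS

end Summit.NavierStokesRegularity.NavierStokesRegularity.Theorems.NoSurvivingEternalViscBddOne.BlockResidueFloor

end
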